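import Summits.QuantumAdvantage.QuantumAdvantage.Theorems.SymplecticPurityDlogGraphFlatFlankA
import Summits.QuantumAdvantage.QuantumAdvantage.Theorems.SymplecticPurityDlogGraphFlatSignedRepGuard

/-!
# Crux `DlogGraphFlat` (stmt-QuantumAdvantage-10732), line `Sketch` — sector A flank, part B

The exceptional multiplier classes of the XOR-differential count of `x ↦ gˣ mod p`: a class
`x ∧ a` (value `W`) with `g^A = (g^W)²` or `g^A = −(g^W)²` (`A = ofBits a`) forces the signed-binary
relation `Σ_{i ∈ a} ±2^i = A − 2W ∈ {±(p−1), ±(p−1)/2}` (`g` has order `p − 1`,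
`g^{(p−1)/2} = −1`, and `|A − 2W| < 2ⁿ ≤ 3(p−1)/2` in the window), so the crux's NAF guard
(transported by `stub_dlogSignedRepGuard`) gives `|a| ≥ n/8`; at most four values of `W` occur,
each on `≤ 2^{n−|a|}` points. Hence the exceptional classes hold `≤ 2^{n−⌊n/8⌋+2}` points, and with
part A (`stub_dlogDiffFlankA`) the registered stub `stub_dlogDiffFlank` follows:
`D(a,a') ≤ 2^{m(a)+m(a')+3} + 2^{n−⌊n/8⌋+2}` for `a ≠ 0`.
-/

set_option linter.dupNamespace false -- D-0017: single-problem summit ⇒ `QuantumAdvantage.QuantumAdvantage` by design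

namespace Summit.QuantumAdvantage.QuantumAdvantage.Theorems.SymplecticPurity

open Finset Literature.Computability.QuantumComplexity Literature.Computability.Cryptography
open Literature.Computability.AlgebraicComplexity.BoolGadgets (ofBits_eq_sum ofBits_injective)

variable {n : ℕ}

/-! ### The signed digits of a class -/

/-- The signed digits `ε_i = ±1` on the mask (`−1` where `x_i = 1`), `0` off it, are digits. -/
theorem classDigits_trichotomy (x a : QReg n) (i : Fin n) :
    (fun i => if a i = true then (if x i = true then (-1 : ℤ) else 1) else 0) i = 0 ∨
    (fun i => if a i = true then (if x i = true then (-1 : ℤ) else 1) else 0) i = 1 ∨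
    (fun i => if a i = true then (if x i = true then (-1 : ℤ) else 1) else 0) i = -1 := by
  dsimp only
  cases x i <;> cases a i <;> simp

/-- The signed digits of a class are supported exactly on the mask. -/
theorem card_classDigits_ne_zero (x a : QReg n) :
    (Finset.univ.filter fun i =>
        (fun i => if a i = true then (if x i = true then (-1 : ℤ) else 1) else 0) i ≠ 0).card =
      (Finset.univ.filter fun j => a j = true).card := by
  congr 1
  ext i
  simp only [Finset.mem_filter, Finset.mem_univ, true_and]
  cases x i <;> cases a i <;> simp

/-- `Σ ε_i 2^i = A − 2W`. -/
theorem sum_classDigits (x a : QReg n) :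
    ∑ i, (fun i => if a i = true then (if x i = true then (-1 : ℤ) else 1) else 0) i * 2 ^ (i : ℕ) =
      (Nat.ofBits a : ℤ) - 2 * (Nat.ofBits (fun j => x j && a j) : ℤ) := by
  rw [ofBits_eq_sum, ofBits_eq_sum]
  push_cast
  rw [Finset.mul_sum, ← Finset.sum_sub_distrib]
  refine Finset.sum_congr rfl fun i _ => ?_
  cases x i <;> cases a i <;> simp
  ring

/-- `W ≤ A`. -/
theorem ofBits_bits_in_le (x a : QReg n) : Nat.ofBits (fun j => x j && a j) ≤ Nat.ofBits a := by
  rw [ofBits_eq_sum, ofBits_eq_sum]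
  refine Finset.sum_le_sum fun i _ => Nat.mul_le_mul_right _ ?_
  cases x i <;> cases a i <;> simp

/-- `A ≠ 2W` for a non-zero mask: look at the lowest set bit of `a`. -/
theorem ofBits_ne_two_mul_bits_in (x a : QReg n) (ha : a ≠ fun _ => false) :
    Nat.ofBits a ≠ 2 * Nat.ofBits (fun j => x j && a j) := by
  classical
  -- the lowest set bit `i₀` of `a`
  obtain ⟨i₀, hi₀, hmin⟩ : ∃ i₀ : Fin n, a i₀ = true ∧ ∀ j : Fin n, (j : ℕ) < i₀ → a j = false := by
    let s := Finset.univ.filter fun i : Fin n => a i = true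
    have hs : s.Nonempty := by
      by_contra h
      rw [Finset.not_nonempty_iff_eq_empty, Finset.filter_eq_empty_iff] at h
      exact ha (funext fun i => by simpa using h (Finset.mem_univ i))
    refine ⟨s.min' hs, ?_, ?_⟩
    · have := Finset.min'_mem s hs
      simpa [s] using this
    · intro j hj
      by_contra hne
      have hj' : j ∈ s := by
        simp only [s, Finset.mem_filter, Finset.mem_univ, true_and]
        cases h : a j
        · exact absurd h hne
        · rfl
      have := Finset.min'_le s j hj'
      exact absurd hj (not_lt.mpr (Fin.le_def.mp this))
  intro heq
  set W := Nat.ofBits (fun j => x j && a j) with hW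
  have hbitA : (Nat.ofBits a).testBit (i₀ : ℕ) = true := by
    rw [Nat.testBit_ofBits_lt _ _ i₀.isLt]
    exact hi₀
  have hbit2 : (2 * W).testBit (i₀ : ℕ) = false := by
    rw [show 2 * W = 2 ^ 1 * W by rw [pow_one], Nat.testBit_two_pow_mul]
    by_cases h0 : (i₀ : ℕ) ≥ 1
    · have hlt : (i₀ : ℕ) - 1 < n := by omega
      rw [decide_eq_true h0, Bool.true_and, hW, Nat.testBit_ofBits_lt _ _ hlt,
        hmin ⟨(i₀ : ℕ) - 1, hlt⟩ (by change (i₀ : ℕ) - 1 < (i₀ : ℕ); omega), Bool.and_false]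
    · rw [decide_eq_false h0, Bool.false_and]
  rw [heq, hbit2] at hbitA
  exact Bool.false_ne_true hbitA

/-! ### Orders in `ZMod p` -/

section Orders

variable {p : ℕ} [Fact p.Prime]

/-- Equal powers of a non-zero element differ by a multiple of its order in the exponent. -/
theorem int_dvd_of_pow_eq_pow {G : ZMod p} (hG0 : G ≠ 0) {s t : ℕ} (h : G ^ s = G ^ t) :
    (orderOf G : ℤ) ∣ (s : ℤ) - t := by
  rcases le_total t s with hts | hst
  · obtain ⟨d, rfl⟩ := Nat.exists_eq_add_of_le hts
    rw [pow_add] at h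
    have h1 : G ^ d = 1 := mul_left_cancel₀ (pow_ne_zero t hG0) (h.trans (mul_one _).symm)
    have hd := orderOf_dvd_of_pow_eq_one h1
    push_cast
    rw [show (t : ℤ) + d - t = d by ring]
    exact_mod_cast hd
  · obtain ⟨d, rfl⟩ := Nat.exists_eq_add_of_le hst
    rw [pow_add] at h
    have h1 : G ^ d = 1 := mul_left_cancel₀ (pow_ne_zero s hG0) (h.symm.trans (mul_one _).symm)
    have hd := orderOf_dvd_of_pow_eq_one h1
    push_cast
    rw [show (s : ℤ) - (s + d) = -d by ring, dvd_neg]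
    exact_mod_cast hd

/-- For an element of order `p − 1` modulo an odd prime `p ≥ 3`, `G^{(p−1)/2} = −1`. -/
theorem pow_half_eq_neg_one {G : ZMod p} (hg : orderOf G = p - 1) (hp3 : 3 ≤ p)
    (hodd : p % 2 = 1) : G ^ ((p - 1) / 2) = -1 := by
  have h1 : G ^ (p - 1) = 1 := by rw [← hg]; exact pow_orderOf_eq_one G
  have hsq : G ^ ((p - 1) / 2) * G ^ ((p - 1) / 2) = 1 := by
    rw [← pow_add, show (p - 1) / 2 + (p - 1) / 2 = p - 1 by omega, h1]
  have hne : G ^ ((p - 1) / 2) ≠ 1 :=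
    pow_ne_one_of_lt_orderOf (by omega) (by rw [hg]; omega)
  exact (mul_self_eq_one_iff.mp hsq).resolve_left hne

end Orders

/-! ### The exceptional classes -/

/-- **Sector A flank, part B.** Under the crux's hypotheses (window, primitivity, NAF guard) and
`4 ≤ n`, for a non-zero mask `a` the exceptional multiplier classes `g^A = ±(g^{W x})²` hold at
most `2^{n − ⌊n/8⌋ + 2}` points. -/
theorem dlogDiff_exceptional_le (n p g : ℕ) (hp : p.Prime) (hpn : p < 2 ^ n)
    (hwin : 2 ^ n ≤ p + 2 ^ (53 * n / 100)) (hg : orderOf (g : ZMod p) = p - 1)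
    (hguard : ∀ c : Fin (n + 1) → ℤ, (∀ i, c i = 0 ∨ c i = 1 ∨ c i = -1) →
      ∑ i, c i * 2 ^ (i : ℕ) = (p : ℤ) - 1 → n ≤ 8 * (Finset.univ.filter fun i => c i ≠ 0).card)
    (hn : 4 ≤ n) (a : QReg n) (ha : a ≠ fun _ => false) :
    (Finset.univ.filter fun x : QReg n =>
        (g : ZMod p) ^ Nat.ofBits a = ((g : ZMod p) ^ Nat.ofBits (fun j => x j && a j)) ^ 2 ∨
        (g : ZMod p) ^ Nat.ofBits a = -((g : ZMod p) ^ Nat.ofBits (fun j => x j && a j)) ^ 2).card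
      ≤ 2 ^ (n - n / 8 + 2) := by
  classical
  haveI := Fact.mk hp
  -- numerics of the window
  have h53 : 53 * n / 100 ≤ n - 2 := by omega
  have hq : 2 ^ (53 * n / 100) ≤ 2 ^ (n - 2) := Nat.pow_le_pow_right (by norm_num) h53
  have h2n : 2 ^ n = 4 * 2 ^ (n - 2) := by
    conv_lhs => rw [show n = (n - 2) + 2 from by omega, Nat.pow_add]
    ring
  have hq4 : 4 ≤ 2 ^ (n - 2) := by
    calc 4 = 2 ^ 2 := by norm_num
      _ ≤ 2 ^ (n - 2) := Nat.pow_le_pow_right (by norm_num) (by omega)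
  have hp3 : 3 * 2 ^ (n - 2) ≤ p := by omega
  have hp12 : 12 ≤ p := by omega
  have hodd : p % 2 = 1 := (Nat.Prime.mod_two_eq_one_iff_ne_two hp).mpr (by omega)
  have hA2 : Nat.ofBits a < 2 ^ n := Nat.ofBits_lt_two_pow a
  -- notation
  set wa : ℕ := (Finset.univ.filter fun j => a j = true).card with hwa
  set G : ZMod p := (g : ZMod p) with hG
  set A : ℕ := Nat.ofBits a with hA
  have hG0 : G ≠ 0 := by
    intro h0
    rw [h0, orderOf_eq_zero_iff'.mpr] at hg
    · omega
    · intro m hm h1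
      rw [zero_pow (Nat.pos_iff_ne_zero.mp hm)] at h1
      exact zero_ne_one h1
  have hhalf : G ^ ((p - 1) / 2) = -1 := pow_half_eq_neg_one hg (by omega) hodd
  have hordZ : ((orderOf G : ℕ) : ℤ) = (p : ℤ) - 1 := by rw [hg]; push_cast [hp.one_le]; ring
  -- (KA) the class `g^A = (g^W)²`
  have KA : ∀ x : QReg n, G ^ A = (G ^ Nat.ofBits (fun j => x j && a j)) ^ 2 →
      (A : ℤ) - 2 * Nat.ofBits (fun j => x j && a j) = (p : ℤ) - 1 ∨
        (A : ℤ) - 2 * Nat.ofBits (fun j => x j && a j) = -((p : ℤ) - 1) := by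
    intro x hx
    have hWA := ofBits_bits_in_le x a
    have hne := ofBits_ne_two_mul_bits_in x a ha
    rw [← hA] at hWA hne
    rw [← pow_mul] at hx
    have hd := int_dvd_of_pow_eq_pow hG0 hx
    rw [hordZ] at hd
    obtain ⟨k, hk⟩ := hd
    push_cast at hk
    have hk1 : k < 2 := by nlinarith
    have hk2 : -2 < k := by nlinarith
    interval_cases k
    · right; linarith
    · exfalso; omega
    · left; linarith
  -- (KB) the class `g^A = −(g^W)²`
  have KB : ∀ x : QReg n, G ^ A = -(G ^ Nat.ofBits (fun j => x j && a j)) ^ 2 →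
      2 * ((A : ℤ) - 2 * Nat.ofBits (fun j => x j && a j)) = (p : ℤ) - 1 ∨
        2 * ((A : ℤ) - 2 * Nat.ofBits (fun j => x j && a j)) = -((p : ℤ) - 1) := by
    intro x hx
    have hWA := ofBits_bits_in_le x a
    rw [← hA] at hWA
    set h : ℕ := (p - 1) / 2 with hh
    have h2 : 2 * h = p - 1 := by omega
    have h3n : 2 ^ n ≤ 3 * h := by omega
    rw [← pow_mul, neg_eq_neg_one_mul, ← hhalf, ← pow_add] at hx
    have hd := int_dvd_of_pow_eq_pow hG0 hx
    rw [hordZ] at hd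
    obtain ⟨k, hk⟩ := hd
    push_cast at hk
    have hhZ : 2 * (h : ℤ) = (p : ℤ) - 1 := by
      have h' : ((p - 1 : ℕ) : ℤ) = (p : ℤ) - 1 := by push_cast [hp.one_le]; ring
      rw [← h']; exact_mod_cast h2
    have h3z : (2 : ℤ) ^ n ≤ 3 * (h : ℤ) := by exact_mod_cast h3n
    have hA2z : (A : ℤ) < 2 ^ n := by exact_mod_cast hA2
    have hWAz : (Nat.ofBits (fun j => x j && a j) : ℤ) ≤ A := by exact_mod_cast hWA
    have hW0 : (0 : ℤ) ≤ Nat.ofBits (fun j => x j && a j) := Nat.cast_nonneg _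
    have hk1 : k < 1 := by
      by_contra hk1
      push Not at hk1
      have : ((p : ℤ) - 1) * 1 ≤ ((p : ℤ) - 1) * k := mul_le_mul_of_nonneg_left hk1 (by linarith)
      nlinarith
    have hk2 : -2 < k := by
      by_contra hk2
      push Not at hk2
      have : ((p : ℤ) - 1) * k ≤ ((p : ℤ) - 1) * (-2) := mul_le_mul_of_nonneg_left hk2 (by linarith)
      nlinarith
    interval_cases k
    · right; linarith
    · left; linarith
  set E := (Finset.univ.filter fun x : QReg n =>
      G ^ A = (G ^ Nat.ofBits (fun j => x j && a j)) ^ 2 ∨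
        G ^ A = -(G ^ Nat.ofBits (fun j => x j && a j)) ^ 2) with hE
  -- four values of `W`
  have hE4 : E.card ≤ 4 * 2 ^ (n - wa) := by
    set C : ℕ → Finset (QReg n) := fun c => Finset.univ.filter fun x : QReg n =>
      Nat.ofBits (fun j => x j && a j) = c with hC
    have hCc : ∀ c, (C c).card ≤ 2 ^ (n - wa) := fun c => card_filter_bits_in_val_le a c
    have hsub : E ⊆ C ((A - (p - 1)) / 2) ∪ C ((A + (p - 1)) / 2) ∪
        (C ((2 * A - (p - 1)) / 4) ∪ C ((2 * A + (p - 1)) / 4)) := by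
      intro x hx
      rw [hE, Finset.mem_filter] at hx
      simp only [Finset.mem_union, hC, Finset.mem_filter, Finset.mem_univ, true_and]
      have hp1 : 1 ≤ p := hp.one_le
      rcases hx.2 with h | h
      · rcases KA x h with e | e
        · left; left; omega
        · left; right; omega
      · rcases KB x h with e | e
        · right; left; omega
        · right; right; omega
    calc E.card ≤ _ := Finset.card_le_card hsub
      _ ≤ _ := Finset.card_union_le _ _
      _ ≤ ((C ((A - (p - 1)) / 2)).card + (C ((A + (p - 1)) / 2)).card) +
            ((C ((2 * A - (p - 1)) / 4)).card + (C ((2 * A + (p - 1)) / 4)).card) :=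
          Nat.add_le_add (Finset.card_union_le _ _) (Finset.card_union_le _ _)
      _ ≤ (2 ^ (n - wa) + 2 ^ (n - wa)) + (2 ^ (n - wa) + 2 ^ (n - wa)) :=
          Nat.add_le_add (Nat.add_le_add (hCc _) (hCc _)) (Nat.add_le_add (hCc _) (hCc _))
      _ = 4 * 2 ^ (n - wa) := by ring
  -- the guard: a non-empty exceptional class forces `|a| ≥ n/8`
  by_cases hEe : E = ∅
  · rw [hEe, Finset.card_empty]; exact Nat.zero_le _
  obtain ⟨x₀, hx₀⟩ := Finset.nonempty_iff_ne_empty.mpr hEe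
  have hwt : n ≤ 8 * wa := by
    rw [hwa, ← card_classDigits_ne_zero x₀ a]
    refine stub_dlogSignedRepGuard n p hguard _ (classDigits_trichotomy x₀ a) ?_
    rw [sum_classDigits, ← hA]
    rw [hE, Finset.mem_filter] at hx₀
    rcases hx₀.2 with h | h
    · rcases KA x₀ h with e | e
      · exact Or.inl e
      · exact Or.inr (Or.inl e)
    · rcases KB x₀ h with e | e
      · exact Or.inr (Or.inr (Or.inl e))
      · exact Or.inr (Or.inr (Or.inr e))
  have hdiv : n / 8 ≤ wa := Nat.div_le_of_le_mul hwt
  calc E.card ≤ 4 * 2 ^ (n - wa) := hE4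
    _ ≤ 4 * 2 ^ (n - n / 8) := Nat.mul_le_mul_left 4 (Nat.pow_le_pow_right (by norm_num) (by omega))
    _ = 2 ^ (n - n / 8 + 2) := by rw [Nat.pow_add]; ring

/-- **Stub `stub_dlogDiffFlank` (sector A, flank)**: under the crux's hypotheses and `4 ≤ n`, for
`a ≠ 0`, `D(a,a') ≤ 2^{m(a)+m(a')+3} + 2^{n−⌊n/8⌋+2}` (`m(·) = min(|·|, n − |·|)`), from
`stub_dlogDiffFlankA` (multiplier classes) and `dlogDiff_exceptional_le` (NAF guard). -/
theorem stub_dlogDiffFlank : ∀ (n p g : ℕ), p.Prime → p < 2 ^ n → 2 ^ n ≤ p + 2 ^ (53 * n / 100) →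
    orderOf (g : ZMod p) = p - 1 →
    (∀ c : Fin (n + 1) → ℤ, (∀ i, c i = 0 ∨ c i = 1 ∨ c i = -1) →
      ∑ i, c i * 2 ^ (i : ℕ) = (p : ℤ) - 1 → n ≤ 8 * (Finset.univ.filter fun i => c i ≠ 0).card) →
    4 ≤ n → ∀ a : QReg n, a ≠ (fun _ => false) → ∀ a' : QReg n,
    (Finset.univ.filter fun x : QReg n =>
        (fun i : Fin n => Bool.xor ((g ^ Nat.ofBits (fun j => Bool.xor (x j) (a j)) % p).testBit (i : ℕ))
          ((g ^ Nat.ofBits x % p).testBit (i : ℕ))) = a').card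
      ≤ 2 ^ (min (Finset.univ.filter fun i => a i = true).card
              (n - (Finset.univ.filter fun i => a i = true).card) +
            min (Finset.univ.filter fun j => a' j = true).card
              (n - (Finset.univ.filter fun j => a' j = true).card) + 3) +
        2 ^ (n - n / 8 + 2) := by
  intro n p g hp hpn hwin hg hguard hn a ha a'
  have hA := stub_dlogDiffFlankA n p g hp hpn hwin hg hn a a'
  have hB := dlogDiff_exceptional_le n p g hp hpn hwin hg hguard hn a ha
  exact le_trans hA (Nat.add_le_add_left hB _)

end Summit.QuantumAdvantage.QuantumAdvantage.Theorems.SymplecticPurity
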